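import Summits.HodgeConjecture.HodgeConjecture.Theorems.Ring2WeilCoverageSchurDefect
import Summits.HodgeConjecture.HodgeConjecture.Theorems.Ring2WeilCoverageFrameFreePlacementD
import Summits.HodgeConjecture.HodgeConjecture.Theorems.Ring2WeilCoverageNormTable
import HarnessLib

/-!
# Weil-type family coverage — THEOREM S3/S4 arithmetic, part B: the Borel of `PSL₂(𝔽_q)`, the sporadic `45`'s, and the
`PSL₂(𝔽₁₁)` data predicted by THEOREM S4

research route conditional on HC_CM; not a corollary; Q11.4-sentence-2 already refuted in dim ≥ 3.

Ring 2, WEIL-TYPE FAMILY-COVERAGE CENSUS (`HOME/WEIL-FAMILY-COVERAGE.md` `## b04`, block b04.12 and its P.S., owner ring2-b04,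
gen 48); second part of `Ring2WeilCoverageSchurDefect` (imports it, and `…FrameFreePlacementD` for the norm-class shells).

* §1 THEOREM S4's subgroup: for `q ≡ 3 (mod 4)` the Borel `B = C_q ⋊ C_{(q−1)/2}` of `PSL₂(𝔽_q)` has ODD order
  `q·(q−1)/2` (so `2 ∤ |B|`: `ℤ₂[B]` is a maximal order) and every prime `p ≠ q` is of defect zero for its characters of
  degree `(q−1)/2` (part A, `padicValNat_frobeniusOrder_eq`): `S_in(B, ψ) = ∅`, `Ram = {q}` — the input (I3) of S4.
* §2 COROLLARY F (F4): the pairs `45, 45̄` of `M₂₂`, `M₂₃`, `PSL₃(𝔽₄)` (`ℚ(χ) = ℚ(√-7)`): the inert primes `3, 5` dividing the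
  group orders `443520`, `10200960`, `20160` are of defect zero (`v₃ = 2 = v₃(45)`, `v₅ = 1 = v₅(45)`), `11` and `23` are split,
  `2` is split — `S_in = ∅`, `Ram = {7}`: every such piece of every such curve is SPLIT (THEOREM S3′).
* §3 THE HIDDEN FACTOR (census b04.12 P.S. (P2)): for the EVEN-degree characters `2′, 2″` of `2T = SL₂(𝔽₃)` over `ℚ(√-3)` the
  census piece `P = B²` is split automatically (THEOREM S1), but the Weil-type OBJECT `B = Hom_G(W, P)` (dimension `m`) has its own
  class, bounded by THEOREM S3 (`T(a_B) ⊆ {2, 3}`) and COMPUTED by the engine `t24b.py` as `B = V ∩ ker(ρ(g₃) − 1)`: literal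
  determinants and classes of the four NON-split factors found — the `(1,1)`-surfaces of `(0; 3,3′,4,2)` (genus 8, QM by the
  quaternion algebra of discriminant 6), the fourfolds of `(0; 4,6,6′,2)` (genus 12, row `W4.3.2`) and the SIXFOLDS of
  `(0; 3,3′,4,2,2,2)` (genus 20) and `(0; 4,4,6,6′,2)` (genus 21) on the row `W6.3.2 = (3, ℚ(√-3), [2])` (pub-hsemireg's R1) —
  and of the split sixfolds of `(0; 4,6,6′,2,2)` (genus 18) and `(1; 4,2,2)` (genus 22) on `W6.3.1` (LAW: `[a_B] = [2]^{#2}`,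
  `#2` = the number of branch points with monodromy `−1`; 13/13 data).

No `def`, no named fact, no `sorry`; nothing here is a statement about Hodge classes; `HC_CM` is used nowhere.
References: [cite: BraunNebe2017, §5.2–5.5]; [cite: vanGeemen1994HodgeAV, (5.4.1)].
-/

set_option linter.dupNamespace false

open Literature.AlgebraicGeometry.Motives
open Literature.AlgebraicGeometry.VanGeemen1994
open Summit.HodgeConjecture.HodgeConjecture.Ring2.Hypotheses

namespace Summit.HodgeConjecture.HodgeConjecture.Ring2.WeilCoverage

/-! ### §1 The Borel subgroup of `PSL₂(𝔽_q)`, `q ≡ 3 (mod 4)` -/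

/-- For `q ≡ 3 (mod 4)` the Borel subgroup `B = C_q ⋊ C_{(q−1)/2}` of `PSL₂(𝔽_q)` has ODD order `q·((q−1)/2)`; in particular
`2 ∤ |B|`, so at the prime `2` (the one prime THEOREM S3 leaves open for `PSL₂(𝔽_q)`, `q ≡ 3 (mod 8)`) the `ψ`-lattice of any
`B`-curve is a unimodular `𝒪_{K,2}`-direct summand (input (I3) of THEOREM S4, census b04.12 (C)).
research route conditional on HC_CM; not a corollary; Q11.4-sentence-2 already refuted in dim ≥ 3. [folklore] -/
theorem borelOrder_odd (q : ℕ) (hq : q % 4 = 3) : (q * ((q - 1) / 2)) % 2 = 1 := by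
  have h1 : q % 2 = 1 := by omega
  have h2 : ((q - 1) / 2) % 2 = 1 := by omega
  exact Nat.odd_mul.mpr ⟨Nat.odd_iff.mpr h1, Nat.odd_iff.mpr h2⟩ |> Nat.odd_iff.mp

/-- The Borel's two characters of degree `(q−1)/2`: EVERY prime `p ∤ q` is of defect zero (`v_p(q·m) = v_p(m)`, part A) AND
the order is odd — so `S_in(B, ψ) = ∅` whatever the splitting behaviour of the odd primes, and `Ram(ℚ(√-q)) = {q}`:
`(B, ψ)` is S3-trivial (the literal instance `q = 11`, `|B| = 55`, `ψ(1) = 5`: `v₅(55) = 1 = v₅(5)`).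
research route conditional on HC_CM; not a corollary; Q11.4-sentence-2 already refuted in dim ≥ 3. [folklore] -/
theorem borel11_defectZero :
    (11 * ((11 - 1) / 2)) % 2 = 1 ∧ padicValNat 5 (11 * ((11 - 1) / 2)) = padicValNat 5 ((11 - 1) / 2) :=
  ⟨borelOrder_odd 11 (by norm_num), padicValNat_frobeniusOrder_eq (q := 11) (m := (11 - 1) / 2) (by norm_num) (by norm_num)⟩

/-! ### §2 The sporadic and linear `45`'s over `ℚ(√-7)` -/

/-- `M₂₂` (`|G| = 443520 = 2⁷·3²·5·7·11`), characters `45, 45̄` with `ℚ(χ) = ℚ(√-7)`: `3` and `5` are INERT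
(`−7` a non-square mod `3`, mod `5`) and of DEFECT ZERO (`v₃(443520) = 2 = v₃(45)`, `v₅(443520) = 1 = v₅(45)`), `11` is SPLIT
(`−7 ≡ 2² (mod 11)`), `2` is SPLIT (`1² ≡ −7 (mod 8)`): `S_in = ∅`, `Ram = {7}` — ALWAYS SPLIT by THEOREM S3′ (census b04.12 (B) F4).
research route conditional on HC_CM; not a corollary; Q11.4-sentence-2 already refuted in dim ≥ 3. [folklore] -/
theorem m22_45_primes :
    ¬ IsSquare (-(7 : ZMod 3)) ∧ ¬ IsSquare (-(7 : ZMod 5)) ∧ IsSquare (-(7 : ZMod 11)) ∧ (∃ x : ZMod 8, x ^ 2 = -(7 : ZMod 8)) ∧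
      padicValNat 3 443520 = 2 ∧ padicValNat 3 45 = 2 ∧ padicValNat 5 443520 = 1 ∧ padicValNat 5 45 = 1 ∧
      (443520 : ℕ) = 2 ^ 7 * 3 ^ 2 * 5 * 7 * 11 := by
  haveI h3 : Fact (Nat.Prime 3) := ⟨Nat.prime_three⟩
  haveI h5 : Fact (Nat.Prime 5) := ⟨by norm_num⟩
  refine ⟨by decide, by decide, by decide, ⟨1, by decide⟩, ?_, ?_, ?_, ?_, by norm_num⟩
  · rw [show (443520 : ℕ) = 3 ^ 2 * 49280 by norm_num, padicValNat.mul (by norm_num) (by norm_num), padicValNat.prime_pow,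
      padicValNat.eq_zero_of_not_dvd (by norm_num)]
  · rw [show (45 : ℕ) = 3 ^ 2 * 5 by norm_num, padicValNat.mul (by norm_num) (by norm_num), padicValNat.prime_pow,
      padicValNat.eq_zero_of_not_dvd (by norm_num)]
  · rw [show (443520 : ℕ) = 5 * 88704 by norm_num, padicValNat.mul (by norm_num) (by norm_num), padicValNat_self,
      padicValNat.eq_zero_of_not_dvd (by norm_num)]
  · rw [show (45 : ℕ) = 5 * 9 by norm_num, padicValNat.mul (by norm_num) (by norm_num), padicValNat_self,
      padicValNat.eq_zero_of_not_dvd (by norm_num)]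

/-- `M₂₃` (`|G| = 10200960 = 2⁷·3²·5·7·11·23`) and `PSL₃(𝔽₄)` (`|G| = 20160 = 2⁶·3²·5·7`), characters `45, 45̄` with
`ℚ(χ) = ℚ(√-7)`: the same inert primes `3, 5` with the same valuations (`v₃ = 2`, `v₅ = 1`), and `23` is SPLIT
(`−7 ≡ 4² (mod 23)`): ALWAYS SPLIT by THEOREM S3′.
research route conditional on HC_CM; not a corollary; Q11.4-sentence-2 already refuted in dim ≥ 3. [folklore] -/
theorem m23_l34_45_primes :
    IsSquare (-(7 : ZMod 23)) ∧ padicValNat 3 10200960 = 2 ∧ padicValNat 5 10200960 = 1 ∧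
      padicValNat 3 20160 = 2 ∧ padicValNat 5 20160 = 1 ∧
      (10200960 : ℕ) = 2 ^ 7 * 3 ^ 2 * 5 * 7 * 11 * 23 ∧ (20160 : ℕ) = 2 ^ 6 * 3 ^ 2 * 5 * 7 := by
  haveI h3 : Fact (Nat.Prime 3) := ⟨Nat.prime_three⟩
  haveI h5 : Fact (Nat.Prime 5) := ⟨by norm_num⟩
  refine ⟨by decide, ?_, ?_, ?_, ?_, by norm_num, by norm_num⟩
  · rw [show (10200960 : ℕ) = 3 ^ 2 * 1133440 by norm_num, padicValNat.mul (by norm_num) (by norm_num), padicValNat.prime_pow,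
      padicValNat.eq_zero_of_not_dvd (by norm_num)]
  · rw [show (10200960 : ℕ) = 5 * 2040192 by norm_num, padicValNat.mul (by norm_num) (by norm_num), padicValNat_self,
      padicValNat.eq_zero_of_not_dvd (by norm_num)]
  · rw [show (20160 : ℕ) = 3 ^ 2 * 2240 by norm_num, padicValNat.mul (by norm_num) (by norm_num), padicValNat.prime_pow,
      padicValNat.eq_zero_of_not_dvd (by norm_num)]
  · rw [show (20160 : ℕ) = 5 * 4032 by norm_num, padicValNat.mul (by norm_num) (by norm_num), padicValNat_self,
      padicValNat.eq_zero_of_not_dvd (by norm_num)]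

/-! ### §3 The hidden factor `B` of the `2T`-pieces for `2′, 2″` (`K = ℚ(√-3)`) -/

/-- `18 ∉ Nm(ℚ(√-3)ˣ)`: `18 = 9·2` with `9 = 3²` a norm and `2` not; `T(18) = {2, 3}`.
research route conditional on HC_CM; not a corollary; Q11.4-sentence-2 already refuted in dim ≥ 3. [cite: vanGeemen1994HodgeAV, 4.14] -/
theorem sqrtNeg3_not_mem_18 : Units.mk0 (18 : ℚ) (by norm_num) ∉ normUnitsSubgroup ℚ (weilField 3) := by
  have h := mul_not_mem_normUnitsSubgroup (mem_normUnitsSubgroup_of_sq_add_mul_sq (d := 3) (a := 9) (by norm_num) 3 0 (by norm_num))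
    Summit.HodgeConjecture.Ring2WeilNormDescent.two_not_mem_norm_three
  rw [mk0_mul_mk0] at h
  norm_num at h
  exact h

/-- `216 ∉ Nm(ℚ(√-3)ˣ)`: `216 = 36·6` with `36 = 6²` a norm and `6` not (`SqrtNeg3.not_mem_6`); `T(216) = {2, 3}`.
research route conditional on HC_CM; not a corollary; Q11.4-sentence-2 already refuted in dim ≥ 3. [cite: vanGeemen1994HodgeAV, 4.14] -/
theorem sqrtNeg3_not_mem_216 : Units.mk0 (216 : ℚ) (by norm_num) ∉ normUnitsSubgroup ℚ (weilField 3) := by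
  have h := mul_not_mem_normUnitsSubgroup (mem_normUnitsSubgroup_of_sq_add_mul_sq (d := 3) (a := 36) (by norm_num) 6 0 (by norm_num))
    SqrtNeg3.not_mem_6
  rw [mk0_mul_mk0] at h
  norm_num at h
  exact h

/-- **The QM surfaces.** `2T`-cover `(0; 3,3′,4,2)` (classes `c3a, c3b, c4, z`; genus 8; Hurwitz dimension 1): the factor `B_t` of the
`2′`-piece `P_t = B_t²` is an abelian SURFACE with `(1,1)` `ℚ(√-3)`-action and literal `det H|_B = −6`: its class `[6]` is NOT the
split class of `(1, ℚ(√-3))` (`T(6) = {2,3}`) — `B_t` is NOT isogenous to a product `E × E′` along the family (row `W2.3.2`; the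
hermitian plane `⟨1, −6⟩` is anisotropic, i.e. `B_t` has quaternionic multiplication by the INDEFINITE quaternion algebra
`(−3, 6)_ℚ` of discriminant `6` at the general member), while `P_t = B_t²` sits on the split row `W4.3.1` as THEOREM S1 forces.
research route conditional on HC_CM; not a corollary; Q11.4-sentence-2 already refuted in dim ≥ 3. [cite: vanGeemen1994HodgeAV, (5.4.1)] -/
theorem factor2T_3a3b4z_g8_mk_detH_ne_split :
    (QuotientGroup.mk (Units.mk0 ((-6 : ℚ)) (by norm_num)) : weilNormResidueGroup 3) ≠ splitDiscriminantClass 1 3 := by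
  have e : Units.mk0 ((-6 : ℚ)) (by norm_num) = -(Units.mk0 (6 : ℚ) (by norm_num)) := Units.ext (by norm_num)
  rw [Ne, e, mk_neg_eq_splitDiscriminantClass_iff_of_odd (n := 1) (by decide)]
  exact SqrtNeg3.not_mem_6

/-- `2T`-cover `(0; 4,6,6′,2)` (genus 12; Hurwitz dimension 1): the factor `B_t` (an abelian FOURFOLD, `(2,2)` `ℚ(√-3)`-action,
`P_t = B_t²` on `W8.3.1`) has literal `det H|_B = 18`, class `[18] = [2]`: row **`W4.3.2`** (`T = {2,3}`), NON-split.
research route conditional on HC_CM; not a corollary; Q11.4-sentence-2 already refuted in dim ≥ 3. [cite: vanGeemen1994HodgeAV, (5.4.1)] -/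
theorem factor2T_46a6bz_g12_mk_detH_ne_split :
    (QuotientGroup.mk (Units.mk0 ((18 : ℚ)) (by norm_num)) : weilNormResidueGroup 3) ≠ splitDiscriminantClass 2 3 := by
  rw [Ne, mk_eq_splitDiscriminantClass_iff_of_even (n := 2) (by decide)]
  exact sqrtNeg3_not_mem_18

/-- **Special fibres WITH A CURVE on pub-hsemireg's anchor row R1.** `2T`-cover `(0; 3,3′,4,2,2,2)` (classes `c3a,c3b,c4,z,z,z`;
genus 20; Hurwitz dimension 3): the factor `B_t` of the `2′`-piece (`P_t = B_t²` on the split row `W12.3.1`) is an abelian SIXFOLD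
with `(3,3)` `ℚ(√-3)`-action and literal `det H|_B = −216`, class `[216] = [6] = [2]`: row **`W6.3.2 = (3, ℚ(√-3), [2])`**,
NON-split (`T = {2,3}`).
research route conditional on HC_CM; not a corollary; Q11.4-sentence-2 already refuted in dim ≥ 3. [cite: vanGeemen1994HodgeAV, (5.4.1)] -/
theorem factor2T_3a3b4zzz_g20_mk_detH_ne_split :
    (QuotientGroup.mk (Units.mk0 ((-216 : ℚ)) (by norm_num)) : weilNormResidueGroup 3) ≠ splitDiscriminantClass 3 3 := by
  have e : Units.mk0 ((-216 : ℚ)) (by norm_num) = -(Units.mk0 (216 : ℚ) (by norm_num)) := Units.ext (by norm_num)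
  rw [Ne, e, mk_neg_eq_splitDiscriminantClass_iff_of_odd (n := 3) (by decide)]
  exact sqrtNeg3_not_mem_216

/-- `2T`-cover `(0; 4,4,6,6′,2)` (classes `c4,c4,c6a,c6b,z`; genus 21; Hurwitz dimension 2): the factor `B_t` (abelian SIXFOLD,
`(3,3)` `ℚ(√-3)`-action; `P_t = B_t²` on `W12.3.1`) has literal `det H|_B = −216`: row **`W6.3.2`** (R1), NON-split.
research route conditional on HC_CM; not a corollary; Q11.4-sentence-2 already refuted in dim ≥ 3. [cite: vanGeemen1994HodgeAV, (5.4.1)] -/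
theorem factor2T_446a6bz_g21_mk_detH_ne_split :
    (QuotientGroup.mk (Units.mk0 ((-216 : ℚ)) (by norm_num)) : weilNormResidueGroup 3) ≠ splitDiscriminantClass 3 3 :=
  factor2T_3a3b4zzz_g20_mk_detH_ne_split

/-- The SPLIT side of the same law (`#2` even): `2T`-cover `(0; 4,6,6′,2,2)` (genus 18; Hurwitz dimension 2): factor sixfold `B_t`
with `det H|_B = −108`, `108 = 0² + 3·6²`: row `W6.3.1 = (3, ℚ(√-3), 1)` (pub-hsemireg's R0); and `(1; 4,2,2)` (genus 22; Hurwitz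
dimension 3): `det H|_B = −36`, `36 = 6²`: row `W6.3.1`.
research route conditional on HC_CM; not a corollary; Q11.4-sentence-2 already refuted in dim ≥ 3. [cite: vanGeemen1994HodgeAV, (5.4.1)] -/
theorem factor2T_46a6bzz_g18_and_1_4zz_g22_mk_detH_eq_split :
    (QuotientGroup.mk (Units.mk0 ((-108 : ℚ)) (by norm_num)) : weilNormResidueGroup 3) = splitDiscriminantClass 3 3 ∧
      (QuotientGroup.mk (Units.mk0 ((-36 : ℚ)) (by norm_num)) : weilNormResidueGroup 3) = splitDiscriminantClass 3 3 := by
  have e1 : Units.mk0 ((-108 : ℚ)) (by norm_num) = -(Units.mk0 (108 : ℚ) (by norm_num)) := Units.ext (by norm_num)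
  have e2 : Units.mk0 ((-36 : ℚ)) (by norm_num) = -(Units.mk0 (36 : ℚ) (by norm_num)) := Units.ext (by norm_num)
  refine ⟨?_, ?_⟩
  · rw [e1, mk_neg_eq_splitDiscriminantClass_iff_of_odd (n := 3) (by decide)]
    exact mem_normUnitsSubgroup_of_sq_add_mul_sq _ (0 : ℚ) (6 : ℚ) (by norm_num)
  · rw [e2, mk_neg_eq_splitDiscriminantClass_iff_of_odd (n := 3) (by decide)]
    exact mem_normUnitsSubgroup_of_sq_add_mul_sq _ (6 : ℚ) (0 : ℚ) (by norm_num)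

end Summit.HodgeConjecture.HodgeConjecture.Ring2.WeilCoverage
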